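import Mathlib
import Summits.Ventures.PercRepro2.EdgeSplit

/-!
# The explored edges as a sub-σ-algebra: conditional expectation given an exploration is the pinned
expectation (blind cell PercRepro2, typer-1 g18; a language line)

`EdgeSplit.lean` identified the conditioned measure `μ_p[|cylinder F σ]` with the product law of the
pinned weights `condWeights p F σ` (p1 g13's `CylinderCond`: the explored edges of `F` forced into
the states of `σ`).  Here the same fact is stated for the σ-algebra `σ(ω_e : e ∈ F)` of the
explored edges (`exploredSigma F = comap (restrictTo F)`), in Mathlib's conditional-expectation
language:

* `exploredMean p F f ω = E_{condWeights p F ω} f` — the pinned mean at the observed pattern;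
* **`condExp_exploredSigma`**: `μ_p[f | exploredSigma F] =ᵐ exploredMean p F f` for EVERY weight
  vector — the conditional expectation given the explored edges IS the pinned expectation
  (the domain Markov property in `condExp` form; `ae_eq_condExp_of_forall_setIntegral_eq` on the
  preimage sets, each a disjoint union of cylinders, `CylinderCond.expect_mul_cylinder_eq` per
  cylinder);
* `expect_exploredMean`: the disintegration `E_p f = E_p[ω ↦ E_{condWeights p F ω} f]`.

Identities only; nothing about the sign of any term.
-/

namespace Summit.Ventures.PercRepro2

open MeasureTheory ProbabilityTheory MeasureBridge

namespace EdgeSplit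

section Exploration

variable {E : Type*} [Fintype E] [DecidableEq E]

/-- The explored pattern: the restriction of a configuration to the edges of `F`. -/
def restrictTo (F : Finset E) (ω : Config E) : (↥F → Bool) := fun e => ω e

/-- A pattern on `F`, extended by `false` off `F`. -/
def extendPat (F : Finset E) (τ : ↥F → Bool) : Config E :=
  fun e => if h : e ∈ F then τ ⟨e, h⟩ else false

omit [Fintype E] in
/-- The cylinder of an extended pattern is the fibre of `restrictTo`. -/
lemma mem_cylinder_extendPat_iff (F : Finset E) (τ : ↥F → Bool) (ω : Config E) :
    ω ∈ cylinder F (extendPat F τ) ↔ restrictTo F ω = τ := by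
  rw [mem_cylinder]
  constructor
  · intro h
    funext e
    have := h e e.2
    simpa [extendPat, e.2, restrictTo] using this
  · intro h e he
    have := congrFun h ⟨e, he⟩
    simpa [extendPat, he, restrictTo] using this

omit [Fintype E] in
/-- `condWeights` only reads the pattern on `F`. -/
lemma condWeights_congr (p : E → ℝ) (F : Finset E) {σ σ' : Config E} (h : ∀ e ∈ F, σ e = σ' e) :
    CylinderCond.condWeights p F σ = CylinderCond.condWeights p F σ' := by
  funext e
  unfold CylinderCond.condWeights
  by_cases he : e ∈ F
  · simp only [he, if_true]
    rw [h e he]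
  · simp only [he, if_false]

omit [Fintype E] in
/-- Extending the observed pattern gives the same pinned weights. -/
lemma condWeights_extendPat_restrictTo (p : E → ℝ) (F : Finset E) (ω : Config E) :
    CylinderCond.condWeights p F (extendPat F (restrictTo F ω)) = CylinderCond.condWeights p F ω :=
  condWeights_congr p F fun e he => by simp [extendPat, restrictTo, he]

/-- The σ-algebra of the explored edges `F`: `σ(ω_e : e ∈ F)`. -/
abbrev exploredSigma (F : Finset E) : MeasurableSpace (Config E) :=
  MeasurableSpace.comap (restrictTo F) inferInstance

omit [Fintype E] [DecidableEq E] in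
/-- `restrictTo F` is measurable. -/
lemma measurable_restrictTo (F : Finset E) : Measurable (restrictTo F) :=
  measurable_pi_iff.mpr fun e => measurable_pi_apply (e : E)

omit [Fintype E] [DecidableEq E] in
/-- The σ-algebra of the explored edges is coarser than the product σ-algebra. -/
lemma exploredSigma_le (F : Finset E) :
    exploredSigma F ≤ (inferInstance : MeasurableSpace (Config E)) :=
  (measurable_restrictTo F).comap_le

/-- The pinned mean at the observed pattern: `ω ↦ E_{condWeights p F ω} f`. -/
noncomputable def exploredMean (p : E → ℝ) (F : Finset E) (f : Config E → ℝ) : Config E → ℝ :=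
  fun ω => expect (CylinderCond.condWeights p F ω) f

/-- `exploredMean` factors through the explored pattern. -/
lemma exploredMean_eq_comp (p : E → ℝ) (F : Finset E) (f : Config E → ℝ) :
    exploredMean p F f =
      (fun τ => expect (CylinderCond.condWeights p F (extendPat F τ)) f) ∘ restrictTo F := by
  funext ω
  simp only [exploredMean, Function.comp]
  rw [condWeights_extendPat_restrictTo]

/-- `E_p[1_{cyl} f] = P_p(cyl) · E_{condWeights}[f]` (p1's `expect_mul_cylinder_eq`, indicator form). -/
lemma expect_indicator_cylinder (p : E → ℝ) (F : Finset E) (σ : Config E) (f : Config E → ℝ) :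
    expect p ((cylinder F σ).indicator f) =
      prob p (cylinder F σ) * expect (CylinderCond.condWeights p F σ) f := by
  have h : (cylinder F σ).indicator f = fun ω => f ω * (cylinder F σ).indicator 1 ω := by
    funext ω
    by_cases hω : ω ∈ cylinder F σ <;> simp [hω]
  rw [h, CylinderCond.expect_mul_cylinder_eq]

/-- On its own cylinder the pinned mean is constant: `E_p[1_{cyl τ} · exploredMean] = P_p(cyl τ) · E_{condWeights τ} f`. -/
lemma expect_indicator_cylinder_exploredMean (p : E → ℝ) (F : Finset E) (τ : ↥F → Bool)
    (f : Config E → ℝ) :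
    expect p ((cylinder F (extendPat F τ)).indicator (exploredMean p F f)) =
      prob p (cylinder F (extendPat F τ)) * expect (CylinderCond.condWeights p F (extendPat F τ)) f := by
  have h : (cylinder F (extendPat F τ)).indicator (exploredMean p F f) =
      fun ω => expect (CylinderCond.condWeights p F (extendPat F τ)) f *
        (cylinder F (extendPat F τ)).indicator 1 ω := by
    funext ω
    by_cases hω : ω ∈ cylinder F (extendPat F τ)
    · rw [Set.indicator_of_mem hω, Set.indicator_of_mem hω, Pi.one_apply, mul_one]
      unfold exploredMean
      rw [condWeights_congr p F (mem_cylinder.mp hω)]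
    · rw [Set.indicator_of_notMem hω, Set.indicator_of_notMem hω, mul_zero]
  rw [h, expect_const_mul, ← prob_eq_expect_indicator, mul_comm]

open scoped Classical in
/-- An expectation over a preimage set of the explored pattern is a sum over the patterns. -/
lemma expect_indicator_preimage_restrictTo (p : E → ℝ) (F : Finset E) (t : Set (↥F → Bool))
    (h : Config E → ℝ) :
    expect p ((restrictTo F ⁻¹' t).indicator h) =
      ∑ τ : ↥F → Bool,
        if τ ∈ t then expect p ((cylinder F (extendPat F τ)).indicator h) else 0 := by
  unfold expect
  rw [← Finset.sum_fiberwise Finset.univ (restrictTo F)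
    (fun ω => weight p ω * (restrictTo F ⁻¹' t).indicator h ω)]
  refine Finset.sum_congr rfl fun τ _ => ?_
  by_cases ht : τ ∈ t
  · rw [if_pos ht, Finset.sum_filter]
    refine Finset.sum_congr rfl fun ω _ => ?_
    by_cases hω : restrictTo F ω = τ
    · have hmem : ω ∈ restrictTo F ⁻¹' t := by
        rw [Set.mem_preimage, hω]
        exact ht
      rw [if_pos hω, Set.indicator_of_mem hmem,
        Set.indicator_of_mem ((mem_cylinder_extendPat_iff F τ ω).mpr hω)]
    · rw [if_neg hω, Set.indicator_of_notMem
        (fun h' => hω ((mem_cylinder_extendPat_iff F τ ω).mp h')), mul_zero]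
  · rw [if_neg ht]
    refine Finset.sum_eq_zero fun ω hω => ?_
    rw [Finset.mem_filter] at hω
    have hnot : ω ∉ restrictTo F ⁻¹' t := by
      rw [Set.mem_preimage, hω.2]
      exact ht
    rw [Set.indicator_of_notMem hnot, mul_zero]

/-- **The conditional expectation given the explored edges is the pinned expectation**:
`μ_p[f | exploredSigma F] =ᵐ exploredMean p F f`, for every weight vector. -/
theorem condExp_exploredSigma (p : E → ℝ) (hp : IsProbVec p) (F : Finset E) (f : Config E → ℝ) :
    (percMeasureOf p hp)[f | exploredSigma F] =ᵐ[percMeasureOf p hp] exploredMean p F f := by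
  refine (ae_eq_condExp_of_forall_setIntegral_eq (exploredSigma_le F) Integrable.of_finite
    (fun _ _ _ => Integrable.of_finite.integrableOn) ?_ ?_).symm
  · intro s hs _
    obtain ⟨t, -, rfl⟩ := hs
    rw [← integral_indicator MeasurableSet.of_discrete, ← integral_indicator MeasurableSet.of_discrete,
      integral_percMeasureOf, integral_percMeasureOf, expect_indicator_preimage_restrictTo,
      expect_indicator_preimage_restrictTo]
    refine Finset.sum_congr rfl fun τ _ => ?_
    by_cases ht : τ ∈ t
    · rw [if_pos ht, if_pos ht, expect_indicator_cylinder_exploredMean, expect_indicator_cylinder]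
    · rw [if_neg ht, if_neg ht]
  · rw [exploredMean_eq_comp]
    exact ((measurable_of_finite _).comp (comap_measurable (restrictTo F))).stronglyMeasurable
      |>.aestronglyMeasurable

/-- **Disintegration over an exploration**: `E_p f = E_p[ω ↦ E_{condWeights p F ω} f]`. -/
theorem expect_exploredMean (p : E → ℝ) (hp : IsProbVec p) (F : Finset E) (f : Config E → ℝ) :
    expect p (exploredMean p F f) = expect p f := by
  rw [← integral_percMeasureOf p hp, ← integral_percMeasureOf p hp,
    ← integral_congr_ae (condExp_exploredSigma p hp F f), integral_condExp (exploredSigma_le F)]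

end Exploration

end EdgeSplit

end Summit.Ventures.PercRepro2
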